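import Mathlib
import HarnessLib
import Summits.Ventures.LatticeQCDFlow.TrivializingMaps.CouplingLadderLawAnyGroup
import Summits.Ventures.LatticeQCDFlow.TrivializingMaps.CouplingKLAnyGroup
import Summits.Ventures.LatticeQCDFlow.TrivializingMaps.SpecificHeatAnyGroup

/-!
# LatticeQCDFlow / Scaling — coupling TRANSFER acceptance = SWAP acceptance; the transfer window
# is `O(1/(N·#plaq))` wide at least (every compact `G`) and `O((1+β)/√#plaq)` wide at most (`SU(n)`)

HONEST FRAMING: exact (Metropolis-corrected) sampling algorithms for lattice gauge theory;
figures of merit are autocorrelation/cost numbers at stated couplings and volumes; no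
continuum-physics claim.

Venture `LatticeQCDFlow` (cell pub-lqcd), topic `Scaling`; FANOUT row 3 (`s0-u1-a`, S0-B
implementation A, GEN-18).  NEW WORK of the cell (assembly), not a published result; NO definition is
introduced.  Parents (all in the tree): lean-2's `TrivializingMaps/CouplingLadderLawAnyGroup`
(`wilson_swapAcc_eq`, `wilson_swapAcc_ge`, `wilson_swapAcc_le_of_floor`, `wilson_variance_le_sq`),
`TrivializingMaps/MeanActionFloorSUN` (`wilson_variance_floor_allCouplings_rep`),
`TrivializingMaps/AnnealingSufficiencyAnyGroup` (`mean_wilsonAction_le/nonneg`),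
`TrivializingMaps/SpecificHeatAnyGroup` (`μ_t = D[U].tilted(t·(−S_W))`), `Scaling/SwapAcceptanceLaw`
(`swapAcc`); Mathlib's `tilted_tilted`, `integral_tilted`, `integral_prod`.

Setting (as in `Scaling/WilsonTransferAcceptanceFloor`): a flow PERFECTLY trained at `β₀` (proposal law
`μ_{β₀} = wilsonMeasure ρ β₀`) re-used as an exact independence sampler at the coupling `β`; its
stationary mean acceptance is row 3's functional
`acc(β₀ → β) = ∫∫ min(p(U), p(U′)) dμ_{β₀} dμ_{β₀}`, `p = e^{−(β−β₀)S}/∫e^{−(β−β₀)S}dμ_{β₀} = dμ_β/dμ_{β₀}`.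

* `swapAcc_symm` — `swapAcc X μ s t = swapAcc X μ t s` (Fubini);
* **`wilsonTransfer_meanAccept_eq_swapAcc`** — THE DICTIONARY: `acc(β₀ → β) = swapAcc(−S_W, D[U], β₀, β)`,
  the parallel-tempering swap rate between the couplings `β₀` and `β` (every compact second-countable
  `G`, continuous `ρ`, `d`, `L`, all real `β₀, β`).  Hence every swap law of lean-2 is a transfer law:
* **`wilsonTransfer_meanAccept_le_of_varianceFloor`** — a specific-heat FLOOR `m ≤ Var_u(S_W)` on the
  segment between `β₀` and `β` forces `acc(β₀ → β) ≤ exp(−m(β − β₀)²/4)`;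
  **`wilsonTransfer_window_le_of_varianceFloor`** — if moreover `acc(β₀ → β) ≥ α > 0` then
  `m(β − β₀)² ≤ 4·log(1/α)`: the window of couplings a trained flow can serve has half-width
  `≤ 2√(log(1/α)/m)`;
* **`wilsonTransfer_meanAccept_ge_allCouplings`** — `acc(β₀ → β) ≥ exp(−√6·N·#plaq·|β − β₀|)` at EVERY
  coupling (trivial ceilings `Var ≤ (N#plaq)²`, `|⟨S⟩_{β₀} − ⟨S⟩_β| ≤ 2N#plaq`);
  **`wilsonTransfer_meanAccept_ge_of_window`** — `√6·N·#plaq·|β − β₀| ≤ log(1/α)` gives `acc ≥ α`: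
  windows of half-width `log(1/α)/(√6·N·#plaq)` are always served;
* **`wilsonTransfer_window_le_sun`** — `SU(n)`, `n ≥ 2`, `d ≥ 2`: one `c = c(n,d) > 0` with
  `c·#plaq·(β − β₀)² ≤ 4(1 + max(β₀,β)²)·log(1/acc(β₀ → β))` for every `L ≥ 2` and all `β₀, β ≥ 0`
  (lean-2's all-coupling variance floor `c·#plaq/(1+u²)`): at fixed acceptance the transfer window
  shrinks like `(1 + β)/√#plaq`, polynomially in the coupling, uniformly in nothing else.

Reading (value-free): between the floor of `Scaling/WilsonTransferAcceptanceFloor` (first order: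
`|β − β₀|·s(β₀)`, `s ≤ √(Var/3)`) and the ceiling here, the number of separately trained flows needed to
cover a coupling range `[a, b]` at acceptance `≥ α` on an `SU(n)` torus is `≳ (b − a)√(c·#plaq)/((1+b)·2√log(1/α))`
and `≲ (b − a)·√6·N·#plaq/log(1/α)` — the same `√volume ≲ K ≲ volume` sandwich as lean-2's replica
ladders, because the two acceptances coincide.  NOT CLAIMED: the true exponent between `½` and `1`;
trained-but-imperfect flows; any value at the cell's `(β, L)`; nothing re-scored.
-/

noncomputable section

namespace Summit.Ventures.LatticeQCDFlow.Theory2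

open MeasureTheory Real Set ProbabilityTheory
open Literature.MathematicalPhysics.QuantumFieldTheory
open Literature.MathematicalPhysics.QuantumFieldTheory.Luscher2010 (trivialMeasure)
open Summit.Ventures.LatticeQCDFlow.Scaling (swapAcc)
open Summit.Ventures.LatticeQCDFlow.TrivializingMaps (wilsonMeasure_eq_tilted_neg integrable_exp_mul_neg_wilsonAction
  trivialMeasure_isProbabilityMeasure wilson_swapAcc_eq wilson_swapAcc_ge wilson_swapAcc_le_of_floor
  wilson_variance_le_sq mean_wilsonAction_le mean_wilsonAction_nonneg wilson_variance_floor_allCouplings_rep)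

/-! ## §0 Symmetry of the swap acceptance -/

section Symm

variable {Ω : Type*} [MeasurableSpace Ω] {μ : Measure Ω} {X : Ω → ℝ}

/-- `swapAcc X μ s t = swapAcc X μ t s` (swap the two coordinates). [folklore] -/
theorem swapAcc_symm (s t : ℝ) : swapAcc X μ s t = swapAcc X μ t s := by
  unfold swapAcc
  rw [← integral_prod_swap]
  refine integral_congr_ae (ae_of_all _ fun p => ?_)
  simp only [Prod.fst_swap, Prod.snd_swap]
  congr 2
  ring

end Symm

/-! ## §1 The dictionary: transfer acceptance = swap acceptance -/

section Wilson

variable {d L N : ℕ} [NeZero L] {G : Type*} [Group G] [TopologicalSpace G] [IsTopologicalGroup G]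
  [CompactSpace G] [MeasurableSpace G] [BorelSpace G] [SecondCountableTopology G]
  (ρ : G →* Matrix (Fin N) (Fin N) ℂ)

/-- `μ_β = μ_{β₀}.tilted(−(β − β₀)·S_W)`: the Wilson family is an exponential family through any of its
members. [folklore] -/
theorem wilsonMeasure_eq_tilted_wilsonMeasure (hρ : Continuous ρ) (β₀ β : ℝ) :
    wilsonMeasure (d := d) (L := L) ρ β =
      (wilsonMeasure (d := d) (L := L) ρ β₀).tilted fun U => -(β - β₀) * wilsonAction ρ U := by
  rw [wilsonMeasure_eq_tilted_neg ρ hρ β₀, tilted_tilted (integrable_exp_mul_neg_wilsonAction ρ hρ β₀),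
    wilsonMeasure_eq_tilted_neg ρ hρ β]
  congr 1
  funext U
  simp only [Pi.add_apply]
  ring

/-- **THE DICTIONARY**: the stationary mean acceptance of the flow trained at `β₀` and re-used at `β`,
`∫∫ min(p(U), p(U′)) dμ_{β₀} dμ_{β₀}` with `p = dμ_β/dμ_{β₀}`, IS the replica-exchange swap rate
`swapAcc(−S_W, D[U], β₀, β)` between the two couplings. [ours] -/
theorem wilsonTransfer_meanAccept_eq_swapAcc (hρ : Continuous ρ) (β₀ β : ℝ) :
    (∫ U, ∫ U',
        min (Real.exp (-(β - β₀) * wilsonAction ρ U)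
            / ∫ V, Real.exp (-(β - β₀) * wilsonAction ρ V) ∂(wilsonMeasure (d := d) (L := L) ρ β₀))
          (Real.exp (-(β - β₀) * wilsonAction ρ U')
            / ∫ V, Real.exp (-(β - β₀) * wilsonAction ρ V) ∂(wilsonMeasure (d := d) (L := L) ρ β₀))
        ∂(wilsonMeasure (d := d) (L := L) ρ β₀) ∂(wilsonMeasure (d := d) (L := L) ρ β₀))
      = swapAcc (fun U => -wilsonAction ρ U) (trivialMeasure G d L) β₀ β := by
  haveI := isProbabilityMeasure_wilsonMeasure (d := d) (L := L) (G := G) ρ hρ β₀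
  haveI := isProbabilityMeasure_wilsonMeasure (d := d) (L := L) (G := G) ρ hρ β
  set μ₀ := wilsonMeasure (d := d) (L := L) (G := G) ρ β₀ with hμ₀
  set Zr : ℝ := ∫ V, Real.exp (-(β - β₀) * wilsonAction ρ V) ∂μ₀ with hZr
  have hSm : Measurable (wilsonAction (d := d) (L := L) (G := G) ρ) := WilsonRP.measurable_wilsonAction ρ hρ
  rw [wilson_swapAcc_eq ρ hρ β₀ β]
  -- Fubini on the swap side (the integrand is bounded and measurable)
  have hFi : Integrable (fun p : GaugeConfig d L G × GaugeConfig d L G =>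
      min 1 (Real.exp ((β - β₀) * (wilsonAction ρ p.2 - wilsonAction ρ p.1))))
      (μ₀.prod (wilsonMeasure (d := d) (L := L) ρ β)) := by
    refine Integrable.of_bound (C := 1) ?_ (ae_of_all _ fun p => ?_)
    · exact (measurable_const.min (measurable_const.mul
        ((hSm.comp measurable_snd).sub (hSm.comp measurable_fst))).exp).aestronglyMeasurable
    · rw [Real.norm_eq_abs, abs_of_nonneg (le_min zero_le_one (Real.exp_pos _).le)]
      exact min_le_left _ _
  rw [integral_prod _ hFi]
  refine integral_congr_ae (ae_of_all _ fun U => ?_)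
  simp only
  rw [wilsonMeasure_eq_tilted_wilsonMeasure ρ hρ β₀ β, integral_tilted]
  refine integral_congr_ae (ae_of_all _ fun V => ?_)
  simp only [smul_eq_mul]
  have hpV : 0 ≤ Real.exp (-(β - β₀) * wilsonAction ρ V) / Zr :=
    div_nonneg (Real.exp_pos _).le (integral_nonneg fun _ => (Real.exp_pos _).le)
  rw [mul_min_of_nonneg _ _ hpV, mul_one, div_mul_eq_mul_div, ← Real.exp_add,
    show -(β - β₀) * wilsonAction ρ V + (β - β₀) * (wilsonAction ρ V - wilsonAction ρ U)
      = -(β - β₀) * wilsonAction ρ U by ring, min_comm]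

/-! ## §2 Transfer laws read off lean-2's swap laws -/

/-- **CEILING UNDER A SPECIFIC-HEAT FLOOR**: `m ≤ Var_u(S_W)` for `u` between `β₀` and `β` gives
`acc(β₀ → β) ≤ exp(−m(β − β₀)²/4)`. [ours] -/
theorem wilsonTransfer_meanAccept_le_of_varianceFloor (hρ : Continuous ρ) {β₀ β m : ℝ}
    (hm : ∀ u ∈ uIcc β₀ β, m ≤ variance (wilsonAction (d := d) (L := L) ρ)
      (wilsonMeasure (d := d) (L := L) ρ u)) :
    (∫ U, ∫ U',
        min (Real.exp (-(β - β₀) * wilsonAction ρ U)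
            / ∫ V, Real.exp (-(β - β₀) * wilsonAction ρ V) ∂(wilsonMeasure (d := d) (L := L) ρ β₀))
          (Real.exp (-(β - β₀) * wilsonAction ρ U')
            / ∫ V, Real.exp (-(β - β₀) * wilsonAction ρ V) ∂(wilsonMeasure (d := d) (L := L) ρ β₀))
        ∂(wilsonMeasure (d := d) (L := L) ρ β₀) ∂(wilsonMeasure (d := d) (L := L) ρ β₀))
      ≤ Real.exp (-(m * (β - β₀) ^ 2 / 4)) := by
  rw [wilsonTransfer_meanAccept_eq_swapAcc ρ hρ β₀ β]
  rcases le_total β₀ β with h | h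
  · exact wilson_swapAcc_le_of_floor ρ hρ h (fun u hu => hm u (by rwa [uIcc_of_le h]))
  · rw [swapAcc_symm, show (β - β₀) ^ 2 = (β₀ - β) ^ 2 by ring]
    exact wilson_swapAcc_le_of_floor ρ hρ h (fun u hu => hm u (by rwa [uIcc_comm, uIcc_of_le h]))

/-- **THE TRANSFER WINDOW UNDER A SPECIFIC-HEAT FLOOR**: if `acc(β₀ → β) ≥ α > 0` and
`m ≤ Var_u(S_W)` between `β₀` and `β`, then `m(β − β₀)² ≤ 4·log(1/α)` — half-width `≤ 2√(log(1/α)/m)`.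
[ours] -/
theorem wilsonTransfer_window_le_of_varianceFloor (hρ : Continuous ρ) {β₀ β m α : ℝ} (hα : 0 < α)
    (hm : ∀ u ∈ uIcc β₀ β, m ≤ variance (wilsonAction (d := d) (L := L) ρ)
      (wilsonMeasure (d := d) (L := L) ρ u))
    (hacc : α ≤ ∫ U, ∫ U',
        min (Real.exp (-(β - β₀) * wilsonAction ρ U)
            / ∫ V, Real.exp (-(β - β₀) * wilsonAction ρ V) ∂(wilsonMeasure (d := d) (L := L) ρ β₀))
          (Real.exp (-(β - β₀) * wilsonAction ρ U')
            / ∫ V, Real.exp (-(β - β₀) * wilsonAction ρ V) ∂(wilsonMeasure (d := d) (L := L) ρ β₀))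
        ∂(wilsonMeasure (d := d) (L := L) ρ β₀) ∂(wilsonMeasure (d := d) (L := L) ρ β₀)) :
    m * (β - β₀) ^ 2 ≤ 4 * Real.log (1 / α) := by
  have h := hacc.trans (wilsonTransfer_meanAccept_le_of_varianceFloor ρ hρ hm)
  have h2 := Real.log_le_log hα h
  rw [Real.log_exp] at h2
  rw [one_div, Real.log_inv]
  linarith

/-- **FLOOR AT EVERY COUPLING**: `acc(β₀ → β) ≥ exp(−√6·N·#plaq·|β − β₀|)` for every compact `G`,
continuous `ρ`, `d`, `L`, `β₀`, `β` (lean-2's swap floor with `Var ≤ (N#plaq)²` twice and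
`(⟨S⟩_{β₀} − ⟨S⟩_β)² ≤ (2N#plaq)²`). [ours] -/
theorem wilsonTransfer_meanAccept_ge_allCouplings (hρ : Continuous ρ) (β₀ β : ℝ) :
    Real.exp (-(Real.sqrt 6 * N * Fintype.card (Plaquette d L) * |β - β₀|)) ≤
      ∫ U, ∫ U',
        min (Real.exp (-(β - β₀) * wilsonAction ρ U)
            / ∫ V, Real.exp (-(β - β₀) * wilsonAction ρ V) ∂(wilsonMeasure (d := d) (L := L) ρ β₀))
          (Real.exp (-(β - β₀) * wilsonAction ρ U')
            / ∫ V, Real.exp (-(β - β₀) * wilsonAction ρ V) ∂(wilsonMeasure (d := d) (L := L) ρ β₀))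
        ∂(wilsonMeasure (d := d) (L := L) ρ β₀) ∂(wilsonMeasure (d := d) (L := L) ρ β₀) := by
  rw [wilsonTransfer_meanAccept_eq_swapAcc ρ hρ β₀ β]
  refine le_trans (Real.exp_le_exp.2 ?_) (wilson_swapAcc_ge ρ hρ β₀ β)
  set P : ℝ := (N : ℝ) * Fintype.card (Plaquette d L) with hP
  have hP0 : 0 ≤ P := by positivity
  have hVa := wilson_variance_le_sq (d := d) (L := L) ρ hρ β₀
  have hVb := wilson_variance_le_sq (d := d) (L := L) ρ hρ β
  have hMa := mean_wilsonAction_le (d := d) (L := L) ρ hρ β₀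
  have hMa0 := mean_wilsonAction_nonneg (d := d) (L := L) ρ hρ β₀
  have hMb := mean_wilsonAction_le (d := d) (L := L) ρ hρ β
  have hMb0 := mean_wilsonAction_nonneg (d := d) (L := L) ρ hρ β
  have hsq : (∫ U, wilsonAction ρ U ∂(wilsonMeasure (d := d) (L := L) ρ β₀) -
      ∫ U, wilsonAction ρ U ∂(wilsonMeasure (d := d) (L := L) ρ β)) ^ 2 ≤ (2 * P) ^ 2 := by
    rw [hP]
    nlinarith
  have hroot : Real.sqrt (variance (wilsonAction (d := d) (L := L) ρ) (wilsonMeasure (d := d) (L := L) ρ β₀) +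
        variance (wilsonAction (d := d) (L := L) ρ) (wilsonMeasure (d := d) (L := L) ρ β) +
        ((∫ U, wilsonAction ρ U ∂(wilsonMeasure (d := d) (L := L) ρ β₀)) -
          ∫ U, wilsonAction ρ U ∂(wilsonMeasure (d := d) (L := L) ρ β)) ^ 2)
      ≤ Real.sqrt 6 * P := by
    rw [show Real.sqrt 6 * P = Real.sqrt (6 * P ^ 2) by
      rw [Real.sqrt_mul (by norm_num : (0:ℝ) ≤ 6), Real.sqrt_sq hP0]]
    refine Real.sqrt_le_sqrt ?_
    have hP2 : ((N : ℝ) * Fintype.card (Plaquette d L)) ^ 2 = P ^ 2 := by rw [hP]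
    have h4 : (2 * P) ^ 2 = 4 * P ^ 2 := by ring
    linarith [hVa, hVb, hsq, hP2, h4]
  have hmul := mul_le_mul_of_nonneg_left hroot (abs_nonneg (β - β₀))
  rw [neg_le_neg_iff]
  calc |β - β₀| * Real.sqrt _ ≤ |β - β₀| * (Real.sqrt 6 * P) := hmul
    _ = Real.sqrt 6 * N * Fintype.card (Plaquette d L) * |β - β₀| := by rw [hP]; ring

/-- **WINDOWS OF HALF-WIDTH `log(1/α)/(√6·N·#plaq)` ARE ALWAYS SERVED**: `√6·N·#plaq·|β − β₀| ≤ log(1/α)`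
with `0 < α` gives `acc(β₀ → β) ≥ α`. [ours] -/
theorem wilsonTransfer_meanAccept_ge_of_window (hρ : Continuous ρ) {β₀ β α : ℝ} (hα : 0 < α)
    (hw : Real.sqrt 6 * N * Fintype.card (Plaquette d L) * |β - β₀| ≤ Real.log (1 / α)) :
    α ≤ ∫ U, ∫ U',
        min (Real.exp (-(β - β₀) * wilsonAction ρ U)
            / ∫ V, Real.exp (-(β - β₀) * wilsonAction ρ V) ∂(wilsonMeasure (d := d) (L := L) ρ β₀))
          (Real.exp (-(β - β₀) * wilsonAction ρ U')
            / ∫ V, Real.exp (-(β - β₀) * wilsonAction ρ V) ∂(wilsonMeasure (d := d) (L := L) ρ β₀))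
        ∂(wilsonMeasure (d := d) (L := L) ρ β₀) ∂(wilsonMeasure (d := d) (L := L) ρ β₀) := by
  refine le_trans ?_ (wilsonTransfer_meanAccept_ge_allCouplings ρ hρ β₀ β)
  rw [one_div, Real.log_inv] at hw
  calc α = Real.exp (Real.log α) := (Real.exp_log hα).symm
    _ ≤ _ := Real.exp_le_exp.2 (by linarith)

end Wilson

/-! ## §3 `SU(n)`: the window shrinks like `(1 + β)/√#plaq` -/

section SUN

variable {d n : ℕ}

/-- **`SU(n)`, `n ≥ 2`, `d ≥ 2`**: one `c = c(n,d) > 0` such that for every `L ≥ 2`, all `β₀, β ≥ 0` and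
every `0 < α ≤ acc(β₀ → β)`:  `c·#plaq·(β − β₀)² ≤ 4·(1 + max β₀ β ²)·log(1/α)` — at fixed acceptance a
flow trained at `β₀` serves a coupling window of half-width `≤ 2(1 + max(β₀,β))·√(log(1/α)/(c·#plaq))`
(lean-2's all-coupling variance floor `c·#plaq/(1+u²)`). [ours] -/
theorem wilsonTransfer_window_le_sun (hn : 2 ≤ n) (hd : 2 ≤ d) :
    ∃ c : ℝ, 0 < c ∧ ∀ (L : ℕ) [NeZero L], 2 ≤ L → ∀ β₀ β α : ℝ, 0 ≤ β₀ → 0 ≤ β → 0 < α →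
      α ≤ (∫ U, ∫ U',
        min (Real.exp (-(β - β₀) * wilsonAction (TrivializingMaps.StrongCoupling.defRep n) U)
            / ∫ V, Real.exp (-(β - β₀) * wilsonAction (TrivializingMaps.StrongCoupling.defRep n) V)
              ∂(wilsonMeasure (d := d) (L := L) (TrivializingMaps.StrongCoupling.defRep n) β₀))
          (Real.exp (-(β - β₀) * wilsonAction (TrivializingMaps.StrongCoupling.defRep n) U')
            / ∫ V, Real.exp (-(β - β₀) * wilsonAction (TrivializingMaps.StrongCoupling.defRep n) V)
              ∂(wilsonMeasure (d := d) (L := L) (TrivializingMaps.StrongCoupling.defRep n) β₀))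
        ∂(wilsonMeasure (d := d) (L := L) (TrivializingMaps.StrongCoupling.defRep n) β₀)
        ∂(wilsonMeasure (d := d) (L := L) (TrivializingMaps.StrongCoupling.defRep n) β₀)) →
      c * Fintype.card (Plaquette d L) * (β - β₀) ^ 2 ≤ 4 * (1 + max β₀ β ^ 2) * Real.log (1 / α) := by
  obtain ⟨c, hc, h⟩ := wilson_variance_floor_allCouplings_rep (d := d) (n := n) hn hd
  refine ⟨c, hc, fun L _ hL β₀ β α h0 h1 hα hacc => ?_⟩
  have hρ : Continuous (TrivializingMaps.StrongCoupling.defRep n) := continuous_subtype_val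
  have hM : 0 < 1 + max β₀ β ^ 2 := by positivity
  have hw := wilsonTransfer_window_le_of_varianceFloor (d := d) (L := L) (TrivializingMaps.StrongCoupling.defRep n) hρ
    (m := c * Fintype.card (Plaquette d L) / (1 + max β₀ β ^ 2)) hα (fun u hu => ?_) hacc
  · rw [div_mul_eq_mul_div, div_le_iff₀ hM] at hw
    linarith
  · have hu0 : 0 ≤ u := by
      rcases mem_uIcc.1 hu with hu' | hu'
      · exact h0.trans hu'.1
      · exact h1.trans hu'.1
    have hule : u ≤ max β₀ β := by
      rcases mem_uIcc.1 hu with hu' | hu'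
      · exact hu'.2.trans (le_max_right _ _)
      · exact hu'.2.trans (le_max_left _ _)
    refine le_trans ?_ (h L hL u hu0)
    have hP : 0 ≤ c * Fintype.card (Plaquette d L) := by positivity
    exact div_le_div_of_nonneg_left hP (by positivity) (by nlinarith)

end SUN

end Summit.Ventures.LatticeQCDFlow.Theory2

end
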